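import Summits.ResolutionOfSingularities.ResolutionOfSingularities.Theorems.MarkedTransferCampaignW36SingularLCIInhabitant
import Literature.AlgebraicGeometry.Hironaka2017.Proofs.S06BaseHike.Eq56ProdCoreFocusLCI
import Literature.AlgebraicGeometry.Hironaka2017.Lib.CoreFocusEdgeData
import Literature.AlgebraicGeometry.Hironaka2017.Lib.CoreFocusEdgeDataAlg
import Literature.AlgebraicGeometry.Hironaka2017.Lib.QuotientRegularOfCotangent
import HarnessLib

/-!
# [OURS · L1 W3.6, G3 SEAT 1] THE CROSS SPECIMEN, BOTH READINGS OF DEF. 4.9 — `¬ Thm6_14_1` (row 040a) for EVERY typed core focus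
# `Ě` with `Σ̄_max = C = V(z,x) ∪ V(z,y)` under ANY edge-data reading implying R1 (`IsEdgeData`) OR R2 (`IsEdgeData_alg`)

Cell `res-hironaka`, rung L, G3 SEAT 1 (label res-L1-s36-pv-3, seat res-D-pv-034): the «R1/R2» clause of res-adj-3 (B) SEAT 1
(2026-08-27T04:29:39Z), completing `MarkedTransferCampaignW36SingularLCIInhabitant` (p512622, reading R1 only). HOST item
stmt-ResolutionOfSingularities-16155 via `--supports` (as every W3.x campaign file).

HONEST FRAMING (D-0012/D-0089). OURS throughout: kernel theorems about the campaign's typed carriers (rows 005b/005d `IsEdgeData` /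
`IsEdgeData_alg`, 010 `IsCoreFocus`, 040a `Thm6_14_1`) at ONE located datum, using G3 SEAT 2's (res-D-pv-027 = res-L1-s36-pv-4)
`r`-bounds at typed core foci with stalkwise-l.c.i. singular locus (`Thm614Part1ExactLCI`, `Lib/CoreFocusEdgeDataAlg`). H. Hironaka's
manuscript (ms. 2017-03-23, lit key `paper:url-3343fd9e678b`) is unrefereed and UNDER ADJUDICATION; nothing of it is asserted or used
as a premise. AI-produced kernel proofs with standard axioms; weaker than expert review.

THE ARGUMENT. Let `Ě` be a typed core focus (`IsCoreFocus ℘ inv Ê Ě`, `0 < Ê.b`, any `inv`) on `𝔸³_K` (`K` algebraically closed)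
with `closure Σ_max(Ê) = C`. Then `Sing(Ě) = C` (`Lib/CoreFocusPAlg`) is an l.c.i. cut at every point (p512622 `isLCICutAt_C`), so SEAT 2's
bounds apply to every edge datum `D` of `Ě` certified in reading R1 OR R2: `r(D) ≤ #S` whenever `(𝓘_C)_ξ ⊆ (S) + 𝔪_ξ²` and `m ≤ r(D)`
for `m` members of `(𝓘_C)_ξ` independent modulo `𝔪_ξ²`. At the cross point `(𝓘_C)_0 = (z, xy) ⊆ (z) + 𝔪²`, so `r ≤ 1`
(`r_le_one_origin`); at a closed branch point `η = (0, b, 0)`, `b ≠ 0`, the members `z, x ∈ (𝓘_C)_η = (z, x)` are part of a regular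
system of parameters, so `2 ≤ r` (`two_le_r_branch`). Since every neighbourhood of the cross point contains closed branch points
(`Thm614Part1CrossNegative.exists_closed_branch_point`), no `r` serves a whole neighbourhood: `¬ Thm6_14_1`
(`not_Thm6_14_1_of_isCoreFocus_readings`); instantiated at `Ê_×` for every certified family and every typed `Ě`
(`not_Thm6_14_1_baseHike_EX_readings`, `not_Thm6_14_1_EX_alg`).

## References (context; nothing below is used as a premise)
* H. Matsumura, Commutative Ring Theory (1987), Thm. 14.2. [cite: Matsumura1987, Thm. 14.2]
* H. Hironaka, ms. 2017-03-23, Def. 4.9 p.20 / Rem. 4.10 p.21 (readings R1/R2), Th. 6.14 (1) p.34 — scope only, under adjudication. [Hironaka2017]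
* Cell records: res-adj-3 (B) SEAT 1 04:29:39Z; SEAT 2 files `Thm614Part1ExactLCI`, `Lib/CoreFocusEdgeDataAlg`; this seat p512622.
-/

noncomputable section

set_option linter.dupNamespace false -- mandated namespace of this single-conjunct summit

open _root_.AlgebraicGeometry _root_.TopologicalSpace _root_.CategoryTheory _root_.IsLocalRing

namespace Summit.ResolutionOfSingularities.ResolutionOfSingularities.Theorems

namespace CrossSpecimenW36

open Literature.AlgebraicGeometry.Resolution Scheme.IdealSheafData
open Literature.AlgebraicGeometry.Hironaka2017
open Literature.AlgebraicGeometry.Hironaka2017.S02Preliminaries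
open Literature.AlgebraicGeometry.Hironaka2017.S04CharAlgebra
open Literature.AlgebraicGeometry.Hironaka2017.S06BaseHike
open Literature.AlgebraicGeometry.Hironaka2017.SpecOrders
open Literature.AlgebraicGeometry.Hironaka2017.CoordArrangement
open Literature.AlgebraicGeometry.Hironaka2017.S06BaseHike.SpecimenA (R Z hom ambient)
open Literature.AlgebraicGeometry.Hironaka2017.S06BaseHike.CrossSpecimen

variable (K : Type) [Field K]

section CoreFocus

variable (p : ℕ) [Fact p.Prime] [CharP K p] {m : ℕ}
  (inv : IdealExponent (Z K) → Z K → Datum.EdgeInv m) (Ehat Ec : IdealExponent (Z K)) (hb : 0 < Ehat.b)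
  (hcf : IsCoreFocus S04CharAlgebra.pAlg inv Ehat Ec)
  (hSig : closure (invmaxStratum (Ehat.sing ∩ S02Preliminaries.closedPoints (Z K)) (inv Ehat)) = (CrossSpecimen.C K : Set (Z K)))

include p hcf hSig in
/-- `Sing(Ě) = C` for a typed core focus whose `Inv_max`-stratum has closure `C` (`Lib/CoreFocusPAlg`). -/
theorem sing_eq_C_of_isCoreFocus : Ec.sing = (CrossSpecimen.C K : Set (Z K)) := by
  rw [sing_eq_closure_invmaxStratum_of_isCoreFocus (ambient K p) inv Ehat hcf, hSig]

include hcf hSig in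
/-- The same as closed subsets. -/
theorem singCloseds_eq_C_of_isCoreFocus :
    (⟨Ec.sing, (ambient K p).isClosed_sing Ec⟩ : Closeds (Z K)) = CrossSpecimen.C K :=
  Closeds.ext (sing_eq_C_of_isCoreFocus K p inv Ehat Ec hcf hSig)

include hcf hSig in
/-- **`Sing(Ě)` is a stalkwise complete intersection** (SEAT 2's binder `hci`, from p512622 `isLCICutAt_C`). -/
theorem hci_of_isCoreFocus :
    ∀ x ∈ ((⟨Ec.sing, (ambient K p).isClosed_sing Ec⟩ : Closeds (Z K)) : Set (Z K)),
      ∃ rs : List ((Z K).presheaf.stalk x), RingTheory.Sequence.IsWeaklyRegular ((Z K).presheaf.stalk x) rs ∧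
        Ideal.ofList rs = stalkIdeal (vanishingIdeal (⟨Ec.sing, (ambient K p).isClosed_sing Ec⟩ : Closeds (Z K))) x := by
  rw [singCloseds_eq_C_of_isCoreFocus K p inv Ehat Ec hcf hSig]
  intro x hx
  obtain ⟨rs, h, e⟩ := isLCICutAt_C K hx
  exact ⟨rs, h.toIsWeaklyRegular, e⟩

include p hb hcf hSig in
/-- **`℘(Ě, a)_ξ = (𝓘_C)_ξ^a`**: the ℘-stalks of `Ě` are the POWER family of `(𝓘_C)_ξ` (res-D-pv-035's
`pAlg_eq_vanishingIdeal_sing_pow_of_isCoreFocus_of_lci` fed by `hci_of_isCoreFocus`). -/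
theorem stalkIdeal_pAlg_eq_pow (a : ℕ) (ξ : Z K) :
    stalkIdeal (pAlg Ec a) ξ = stalkIdeal (vanishingIdeal (CrossSpecimen.C K)) ξ ^ a := by
  rw [pAlg_eq_vanishingIdeal_sing_pow_of_isCoreFocus_of_lci (ambient K p) inv Ehat hb hcf
    (hci_of_isCoreFocus K p inv Ehat Ec hcf hSig) a, stalkIdeal_pow, singCloseds_eq_C_of_isCoreFocus K p inv Ehat Ec hcf hSig]

include hb hcf hSig in
/-- **Every edge datum of `Ě` certified in reading R1 OR R2 is exponent-free** (`e_j = 0`; res-type-010 / SEAT 2's power-family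
lemmas `EdgeDatum.expo_eq_zero_of_isEdgeData(_alg)_pow`), at every `ξ ∈ Sing(Ě) = C`; hence `r = t`. -/
theorem r_eq_t_of_readings {n : ℕ} {ξ : Z K} (hξ : ξ ∈ (CrossSpecimen.C K : Set (Z K))) (D : EdgeDatumAt p n Ec ξ)
    (hD : S04CharAlgebra.IsEdgeData D ∨ IsEdgeData_alg D) : D.r = D.t := by
  have hP : ∀ d, stalkIdeal (pAlg Ec d) ξ = stalkIdeal (vanishingIdeal (CrossSpecimen.C K)) ξ ^ d :=
    fun d => stalkIdeal_pAlg_eq_pow K p inv Ehat Ec hb hcf hSig d ξ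
  have hmax : stalkIdeal (vanishingIdeal (CrossSpecimen.C K)) ξ ≤ maximalIdeal _ := by
    rw [← mem_support_iff_stalkIdeal_le, ← SetLike.mem_coe, Scheme.IdealSheafData.coe_support_vanishingIdeal]
    exact hξ
  have hexpo : ∀ j, D.expo j = 0 := fun j => by
    rcases hD with hD | hD
    · exact EdgeDatum.expo_eq_zero_of_isEdgeData_pow (fun d => stalkIdeal (pAlg Ec d) ξ) _ hP hmax D hD j
    · exact EdgeDatum.expo_eq_zero_of_isEdgeData_alg_pow _ hP hmax D hD j
  unfold EdgeDatum.t
  rw [Finset.filter_true_of_mem fun j _ => hexpo j, Finset.card_univ, Fintype.card_fin]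

include hb hcf hSig in
/-- **`r ≤ 1` at the cross point**, for every edge datum of `Ě` certified in reading R1 or R2: `(𝓘_C)_0 = (z, xy) ⊆ (z) + 𝔪_0²`
(`Lib/EdgeDatumDegreeOneCount.t_le_card_of_le_span_sup_sq`). -/
theorem r_le_one_origin {n : ℕ} (D : EdgeDatumAt p n Ec (CoordChart.origin K (Fin 3)))
    (hD : S04CharAlgebra.IsEdgeData D ∨ IsEdgeData_alg D) : D.r ≤ 1 := by
  classical
  let P := CoordChart.origin K (Fin 3)
  haveI := (ambient K p).isNoetherian_ambient
  have hXP : ∀ i : Fin 3, (MvPolynomial.X i : R K) ∈ P.asIdeal := fun i =>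
    show (MvPolynomial.X i : R K) ∈ MvPolynomial.idealOfVars (Fin 3) K from Ideal.subset_span (Set.mem_range_self i)
  have hgm : ∀ i : Fin 3, gm P (MvPolynomial.X i) ∈ maximalIdeal (St (R K) P) := fun i =>
    (IsLocalization.AtPrime.to_map_mem_maximal_iff (St (R K) P) P.asIdeal _).mpr (hXP i)
  let S : Finset (St (R K) P) := {gm P (MvPolynomial.X 0)}
  have hS : ∀ s ∈ S, s ∈ maximalIdeal (St (R K) P) := by
    intro s hs
    rw [Finset.mem_singleton] at hs
    rw [hs]; exact hgm 0
  have hle : stalkIdeal (pAlg Ec 1) P ⊓ maximalIdeal (St (R K) P) ≤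
      Ideal.span (S : Set (St (R K) P)) ⊔ maximalIdeal (St (R K) P) ^ 2 := by
    refine inf_le_left.trans ?_
    rw [stalkIdeal_pAlg_eq_pow K p inv Ehat Ec hb hcf hSig, pow_one, stalkIdeal_vanishingIdeal_C, Ideal.ofList,
      Ideal.span_le]
    intro q hq
    simp only [List.mem_cons, List.mem_nil_iff, or_false, Set.mem_setOf_eq] at hq
    rcases hq with rfl | rfl
    · exact Ideal.mem_sup_left (Ideal.subset_span (by simp [S]))
    · refine Ideal.mem_sup_right ?_
      dsimp only [gm]
      rw [map_mul, pow_two]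
      exact Ideal.mul_mem_mul (hgm 2) (hgm 1)
  have h := D.t_le_card_of_le_span_sup_sq S hS hle
  rw [← r_eq_t_of_readings K p inv Ehat Ec hb hcf hSig (origin_mem_C K) D hD, Finset.card_singleton] at h
  exact h

include hb hcf hSig in
/-- **`2 ≤ r` at a closed branch point `η = (0, b, 0)`, `b ≠ 0`**, for every edge datum of `Ě` certified in reading R1 or R2: `z, x`
lie in `(𝓘_C)_η = (z, xy)·𝒪_η` (`y` is a unit) and are part of a regular system of parameters, hence independent modulo `𝔪_η²`
(`IsRsopPart.forall_mem_maximalIdeal_of_sum_mul_mem_sq`, `Lib/EdgeDatumDegreeOneCount.le_t_of_forall_sum_mem_sq`). -/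
theorem two_le_r_branch {n : ℕ} {η : Z K} {v : Fin 3 → K} (hv : η.asIdeal = MvPolynomial.vanishingIdeal K {v})
    (hv0 : v 0 = 0) (hv2 : v 2 = 0) (hv1 : v 1 ≠ 0) (D : EdgeDatumAt p n Ec η)
    (hD : S04CharAlgebra.IsEdgeData D ∨ IsEdgeData_alg D) : 2 ≤ D.r := by
  classical
  haveI := (ambient K p).isNoetherian_ambient
  have hηcl : η ∈ S02Preliminaries.closedPoints (Z K) := mem_closedPoints_of_eq_vanishingIdeal K hv
  have hηC : η ∈ (CrossSpecimen.C K : Set (Z K)) := by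
    rw [mem_C_iff_of_eq_vanishingIdeal K hv]
    exact ⟨hv0, Or.inl hv2⟩
  -- the pair `(germ z, germ x)`, a sub-frame of the translated frame `xT`
  let y : Fin 2 → St (R K) η := ![gm η (MvPolynomial.X 0), gm η (MvPolynomial.X 2)]
  let ι : Fin 2 → Fin 3 := ![0, 2]
  have hι : Function.Injective ι := by decide
  have hyeq : xT K η v ∘ ι = y := by
    funext i
    fin_cases i
    · show gm η (MvPolynomial.X 0 - MvPolynomial.C (v 0)) = gm η (MvPolynomial.X 0)
      rw [hv0, map_zero, sub_zero]
    · show gm η (MvPolynomial.X 2 - MvPolynomial.C (v 2)) = gm η (MvPolynomial.X 2)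
      rw [hv2, map_zero, sub_zero]
  haveI := (isRegularLocalRing_and_spanFinrank K p hηcl).1
  have hpart : IsRsopPart y :=
    hyeq ▸ isRsopPart_comp_of_rsop (isRegularLocalRing_and_spanFinrank K p hηcl).2 _ (span_xT K hv) ι hι
  have hli : ∀ c : Fin 2 → St (R K) η, ∑ i, c i * y i ∈ maximalIdeal (St (R K) η) ^ 2 →
      ∀ i, c i ∈ maximalIdeal (St (R K) η) := fun c hc i => hpart.forall_mem_maximalIdeal_of_sum_mul_mem_sq c hc i
  have hmem : ∀ i, y i ∈ stalkIdeal (vanishingIdeal (CrossSpecimen.C K)) η := by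
    rw [stalkIdeal_vanishingIdeal_C]
    have h0 : y 0 ∈ Ideal.ofList [gm η (MvPolynomial.X 0), gm η (MvPolynomial.X 2 * MvPolynomial.X 1)] :=
      Ideal.subset_span (by simp [y])
    -- `germ x = germ (xy) · (germ y)⁻¹`
    obtain ⟨u, hu⟩ := isUnit_germ_X1 (K := K) hv hv1
    have hxy : gm η (MvPolynomial.X 2 * MvPolynomial.X 1) ∈
        Ideal.ofList [gm η (MvPolynomial.X 0), gm η (MvPolynomial.X 2 * MvPolynomial.X 1)] :=
      Ideal.subset_span (by simp)
    have e : y 1 = gm η (MvPolynomial.X 2 * MvPolynomial.X 1) * ↑u⁻¹ := by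
      show gm η (MvPolynomial.X 2) = _
      dsimp only [gm] at hu ⊢
      rw [map_mul, ← hu, mul_assoc, Units.mul_inv, mul_one]
    have h1 : y 1 ∈ Ideal.ofList [gm η (MvPolynomial.X 0), gm η (MvPolynomial.X 2 * MvPolynomial.X 1)] := by
      rw [e]
      exact Ideal.mul_mem_right _ _ hxy
    intro i
    fin_cases i
    exacts [h0, h1]
  have hmax : stalkIdeal (vanishingIdeal (CrossSpecimen.C K)) η ≤ maximalIdeal _ := by
    rw [← mem_support_iff_stalkIdeal_le, ← SetLike.mem_coe, Scheme.IdealSheafData.coe_support_vanishingIdeal]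
    exact hηC
  have hspan := show ∀ b ∈ stalkIdeal (pAlg Ec 1) η, b ∈ maximalIdeal _ →
      ∃ c : Fin D.r → St (R K) η, (∀ j, D.expo j ≠ 0 → c j = 0) ∧ b - ∑ j, c j * D.g j ∈ maximalIdeal _ ^ 2 by
    rcases hD with hD | hD
    · exact D.degOneSpan_of_isEdgeData hD
    · exact D.degOneSpan_of_isEdgeData_alg hD
  have h := D.le_t_of_forall_sum_mem_sq hspan y
    (fun i => by rw [stalkIdeal_pAlg_eq_pow K p inv Ehat Ec hb hcf hSig, pow_one]; exact hmem i)
    (fun i => hmax (hmem i)) hli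
  rw [← r_eq_t_of_readings K p inv Ehat Ec hb hcf hSig hηC D hD] at h
  exact h

include hb hcf hSig in
/-- **`¬ Thm6_14_1` for every typed core focus `Ě` with `Σ̄_max = C`, under ANY edge-data reading implying R1 OR R2**
(`IsEdgeData' η D → IsEdgeData D ∨ IsEdgeData_alg D`): Th. 6.14 (1) as typed asks for ONE `r` serving all closed singular points of
a neighbourhood of the cross point; but `r ≤ 1` there and `r ≥ 2` at the closed branch points every such neighbourhood contains. -/
theorem not_Thm6_14_1_of_isCoreFocus_readings [IsAlgClosed K] (n : ℕ)
    (IsCoreFocusOf : IdealExponent (Z K) → IdealExponent (Z K) → Prop) (E : IdealExponent (Z K)) (hE : E.IsStandard)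
    (hEc : IsCoreFocusOf (baseHike E) Ec) (IsEdgeData' : (η : Z K) → EdgeDatumAt p n Ec η → Prop)
    (hR : ∀ η (D : EdgeDatumAt p n Ec η), IsEdgeData' η D → S04CharAlgebra.IsEdgeData D ∨ IsEdgeData_alg D) :
    ¬ Thm6_14_1 (ambient K p) n IsCoreFocusOf E Ec hE hEc IsEdgeData' := by
  intro hT
  have hsing := sing_eq_C_of_isCoreFocus K p inv Ehat Ec hcf hSig
  have h0sing : CoordChart.origin K (Fin 3) ∈ Ec.sing := by rw [hsing]; exact origin_mem_C K
  obtain ⟨V, h0V, hV⟩ := hT (CoordChart.origin K (Fin 3)) h0sing 1 Nat.one_pos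
  obtain ⟨r, g, hprop⟩ := hV 1 le_rfl
  -- at the cross point: `r ≤ 1`
  obtain ⟨D₀, hD₀', hr₀, -⟩ := hprop (CoordChart.origin K (Fin 3)) h0V CoordChart.isClosed_origin h0sing
  have hr1 : r ≤ 1 := hr₀ ▸ r_le_one_origin K p inv Ehat Ec hb hcf hSig D₀ (hR _ D₀ hD₀')
  -- at a closed branch point of `V`: `2 ≤ r`
  obtain ⟨η, v, hηV, hηcl, hv, hv0, hv2, hv1⟩ := exists_closed_branch_point K p
    (V := ((V : (Z K).Opens) : Set (Z K))) (V : (Z K).Opens).isOpen h0V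
  have hηsing : η ∈ Ec.sing := by
    rw [hsing, mem_C_iff_of_eq_vanishingIdeal K hv]
    exact ⟨hv0, Or.inl hv2⟩
  obtain ⟨D₁, hD₁', hr₁, -⟩ := hprop η hηV hηcl hηsing
  have hr2 : 2 ≤ r := hr₁ ▸ two_le_r_branch K p inv Ehat Ec hb hcf hSig hv hv0 hv2 hv1 D₁ (hR _ D₁ hD₁')
  omega

end CoreFocus

/-! ## At the located `Ê_×`: every certified family, every typed core focus, both readings -/

section Instance

variable [CharP K 2] [IsAlgClosed K]

/-- **`¬ Thm6_14_1` FOR EVERY TYPED CORE FOCUS `Ě` OF `Ê_×`, under any reading implying R1 OR R2** (every `n`, every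
`IsCoreFocusOf` / standard `E`). -/
theorem not_Thm6_14_1_baseHike_EX_readings (n : ℕ) {m : ℕ} (ed : EdgeDataOn 2 m (baseHike (EX K)))
    (hed : IsEdgeDataOn CampaignW31.edgeDataProvenance (baseHike (EX K)) ed) (Ec : IdealExponent (Z K))
    (hcf : IsCoreFocus S04CharAlgebra.pAlg (invInst (baseHike (EX K)) ed) (baseHike (EX K)) Ec)
    (IsCoreFocusOf : IdealExponent (Z K) → IdealExponent (Z K) → Prop) (E : IdealExponent (Z K)) (hE : E.IsStandard)
    (hEc : IsCoreFocusOf (baseHike E) Ec) (IsEdgeData' : (η : Z K) → EdgeDatumAt 2 n Ec η → Prop)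
    (hR : ∀ η (D : EdgeDatumAt 2 n Ec η), IsEdgeData' η D → S04CharAlgebra.IsEdgeData D ∨ IsEdgeData_alg D) :
    ¬ Thm6_14_1 (ambient K 2) n IsCoreFocusOf E Ec hE hEc IsEdgeData' :=
  not_Thm6_14_1_of_isCoreFocus_readings K 2 (invInst (baseHike (EX K)) ed) (baseHike (EX K)) Ec (baseHike_b_pos K) hcf
    (closure_invmaxStratum_eq_C (baseHike_EX K) ed hed) n IsCoreFocusOf E hE hEc IsEdgeData' hR

/-- **Reading R2 itself** (`IsEdgeData' := IsEdgeData_alg`, Rem. 4.10 «generators of `℘(E)(ξ)` as `κ_ξ`-algebra») at the located pair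
`(E_×, Ě)`, for every typed core focus `Ě` of `Ê_×`. -/
theorem not_Thm6_14_1_EX_alg (n : ℕ) {m : ℕ} (ed : EdgeDataOn 2 m (baseHike (EX K)))
    (hed : IsEdgeDataOn CampaignW31.edgeDataProvenance (baseHike (EX K)) ed) (Ec : IdealExponent (Z K))
    (hcf : IsCoreFocus S04CharAlgebra.pAlg (invInst (baseHike (EX K)) ed) (baseHike (EX K)) Ec) :
    ¬ Thm6_14_1 (ambient K 2) n (IsCoreFocus S04CharAlgebra.pAlg (invInst (baseHike (EX K)) ed)) (EX K) Ec
        (isStandard_EX K) hcf (fun _ D => IsEdgeData_alg D) :=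
  not_Thm6_14_1_baseHike_EX_readings K n ed hed Ec hcf _ (EX K) (isStandard_EX K) hcf _ fun _ _ h => Or.inr h

/-- **The inhabitant, both readings**: a standard `E` on `𝔸³` with a certified family `ed` such that `Σ̄_max(Ê)` is a singular l.c.i.
cut, the typed `Ě` exists, and `¬ Thm6_14_1` for every typed core focus `Ě`, every `n`, and every reading implying R1 or R2. -/
theorem crossSpecimen_inhabitant_readings :
    ∃ (E : IdealExponent (Z K)) (hE : E.IsStandard) (ed : EdgeDataOn 2 3 (baseHike E)),
      IsEdgeDataOn CampaignW31.edgeDataProvenance (baseHike E) ed ∧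
      CampaignW36.LCIClass (baseHike E)
        (invmaxStratum ((baseHike E).sing ∩ S02Preliminaries.closedPoints (Z K)) (invField (baseHike E) ed)) ∧
      ¬ CampaignW31.InvmaxClosureRegularOn ((baseHike E).sing ∩ S02Preliminaries.closedPoints (Z K))
        (invField (baseHike E) ed) ∧
      (∃ Ec : IdealExponent (Z K), IsCoreFocus S04CharAlgebra.pAlg (invInst (baseHike E) ed) (baseHike E) Ec) ∧
      ∀ (Ec : IdealExponent (Z K)) (hEc : IsCoreFocus S04CharAlgebra.pAlg (invInst (baseHike E) ed) (baseHike E) Ec)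
        (n : ℕ) (IsEdgeData' : (η : Z K) → EdgeDatumAt 2 n Ec η → Prop),
        (∀ η (D : EdgeDatumAt 2 n Ec η), IsEdgeData' η D → S04CharAlgebra.IsEdgeData D ∨ IsEdgeData_alg D) →
          ¬ Thm6_14_1 (ambient K 2) n (IsCoreFocus S04CharAlgebra.pAlg (invInst (baseHike E) ed)) E Ec hE hEc IsEdgeData' :=
  ⟨EX K, isStandard_EX K, edgeDataOn_of_eq (baseHike_EX K), isEdgeDataOn_edgeDataOn_of_eq (baseHike_EX K),
    lciClass_baseHike_EX K _ (isEdgeDataOn_edgeDataOn_of_eq (baseHike_EX K)),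
    not_invmaxClosureRegularOn_baseHike_EX K _ (isEdgeDataOn_edgeDataOn_of_eq (baseHike_EX K)),
    exists_isCoreFocus_baseHike_EX K _ (isEdgeDataOn_edgeDataOn_of_eq (baseHike_EX K)),
    fun Ec hEc n IsEdgeData' hR =>
      not_Thm6_14_1_baseHike_EX_readings K n _ (isEdgeDataOn_edgeDataOn_of_eq (baseHike_EX K)) Ec hEc _
        (EX K) (isStandard_EX K) hEc IsEdgeData' hR⟩

end Instance

end CrossSpecimenW36

end Summit.ResolutionOfSingularities.ResolutionOfSingularities.Theorems

end
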